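import Literature.NumberTheory.CubicFields.CubicFieldDiscriminant12163
import HarnessLib

/-!
# The cubic field of discriminant `−12163` (LMFDB 3.1.12163.1), part 2: the primes above `p ≤ 11` are principal — PROVED

Sequel of `CubicFieldDiscriminant12163.lean` (same seat, same namespace `Literature.NumberTheory.CubicFields.CubicDisc12163`; §1–§2 there: the polynomial,
`d_F = −12163`, `𝓞_F = ℤ[θ]`, signature).  THEOREMS ONLY; every statement PROVED.  §3 (first half, this file): the `θ`-relation and
every prime of `𝓞_F` above `p ≤ 11` is principal (explicit generators / inert primes, Dedekind–Kummer); the primes above `13 ≤ p ≤ 31` and §4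
(★ `h_F = 1` by Minkowski, `not_two_dvd_classNumber`) are in the sequel `CubicFieldDiscriminant12163ClassNumber.lean`.  Written by the prover seat `bsd-line-att-p4` g38 (cell `bsd-f1-sign2`; g27's template) for the curve `[1,1,1,−4,−8]` of conductor
`12163 (prime)` on the doors-dead sub-cell (u1/u7) of crux C2 — the datum «`h(ℚ(β)) = 1`» of att-p3's / att-p5's class-group doors.

References: [LMFDB] number field 3.1.12163.1 (class number 1); [Marcus2018] Ch. 3 Thm. 27, Ch. 5 Thm. 37 and Cor. 2.
-/

noncomputable section

open Polynomial NumberField NumberField.InfinitePlace Ideal Module Real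
open Literature.NumberTheory.NumberFields
open Literature.NumberTheory.NumberFields.MonicCubic

namespace Literature.NumberTheory.CubicFields.CubicDisc12163

section NumberField

variable {F : Type*} [Field F] [NumberField F] {α : F}

/-! ## §3 The primes of norm `≤ 31` are principal -/

/-- The cubic relation `θ³ + aθ² + bθ + c = 0` in `𝓞_F`, numerals pushed (private helper). [folklore] -/
private theorem theta_rel (hα : aeval α (poly (-3) (7) (16)) = 0) :
    thetaInt hα ^ 3 + (-3) * thetaInt hα ^ 2 + (7) * thetaInt hα + (16) = 0 := by
  have h := thetaInt_rel hα
  push_cast at h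
  linear_combination h

/-- `(2, θ + 0) = (-2 + θ + 2 * θ ^ 2)` (an element of norm `±2`). [cite: Marcus2018, Ch. 3, Thm. 27] -/
theorem span_2_lin0_eq (hα : aeval α (poly (-3) (7) (16)) = 0) :
    span {(2 : 𝓞 F), thetaInt hα} = span {-2 + thetaInt hα + 2 * thetaInt hα ^ 2} := by
  have hrel := theta_rel hα
  apply le_antisymm
  · rw [span_le]
    rintro x hx
    rcases hx with rfl | hx
    · exact mem_span_singleton'.mpr ⟨487 - 167 * thetaInt hα + 39 * thetaInt hα ^ 2, by linear_combination (-61 + 78 * thetaInt hα) * hrel⟩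
    · rw [Set.mem_singleton_iff.mp hx]
      exact mem_span_singleton'.mpr ⟨-312 + 107 * thetaInt hα - 25 * thetaInt hα ^ 2, by linear_combination (39 - 50 * thetaInt hα) * hrel⟩
  · rw [span_singleton_le_iff_mem, mem_span_pair]
    exact ⟨-41 - 14 * thetaInt hα + 11 * thetaInt hα ^ 2, -6 - 5 * thetaInt hα - 5 * thetaInt hα ^ 2, by linear_combination (-5) * hrel⟩

/-- `(2, θ² + 1θ + 1) = (487 - 167 * θ + 39 * θ ^ 2)` (an element of norm `4`). [cite: Marcus2018, Ch. 3, Thm. 27] -/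
theorem span_2_quad_eq (hα : aeval α (poly (-3) (7) (16)) = 0) :
    span {(2 : 𝓞 F), thetaInt hα ^ 2 + thetaInt hα + 1} = span {487 - 167 * thetaInt hα + 39 * thetaInt hα ^ 2} := by
  have hrel := theta_rel hα
  apply le_antisymm
  · rw [span_le]
    rintro x hx
    rcases hx with rfl | hx
    · exact mem_span_singleton'.mpr ⟨-2 + thetaInt hα + 2 * thetaInt hα ^ 2, by linear_combination (-61 + 78 * thetaInt hα) * hrel⟩
    · rw [Set.mem_singleton_iff.mp hx]
      exact mem_span_singleton'.mpr ⟨-73 - 48 * thetaInt hα + 7 * thetaInt hα ^ 2, by linear_combination (-2222 + 273 * thetaInt hα) * hrel⟩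
  · rw [span_singleton_le_iff_mem, mem_span_pair]
    exact ⟨6 - 231 * thetaInt hα + 52 * thetaInt hα ^ 2, -5 - 6 * thetaInt hα - 6 * thetaInt hα ^ 2, by linear_combination (-30 - 6 * thetaInt hα) * hrel⟩

/-- **Every prime of `𝓞_F` above `2` is principal** (Dedekind–Kummer with `polyMod_2` and the generators above).
[cite: Marcus2018, Ch. 3, Thm. 27] [cite: LMFDB, number field 3.1.12163.1 (class number 1)] -/
theorem isPrincipal_of_mem_primesOver_2 (h3 : finrank ℚ F = 3) (hα : aeval α (poly (-3) (7) (16)) = 0) {P : Ideal (𝓞 F)}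
    (hP : P ∈ primesOver (span {((2 : ℕ) : ℤ)}) (𝓞 F)) : Submodule.IsPrincipal P := by
  haveI : Fact (Nat.Prime 2) := ⟨by norm_num⟩
  obtain ⟨Qb, hirr, hmon, hdvd, -, hspan⟩ :=
    exists_factor_of_mem_primesOver irreducible_polyQ hα h3 isUnit_of_disc_eq_sq_mul (by norm_num : Nat.Prime 2) hP
  rw [polyMod_2] at hdvd
  rcases hirr.prime.dvd_or_dvd hdvd with h | h
  · have hQb : Qb = X := eq_of_monic_of_associated hmon monic_X (hirr.associated_of_dvd irreducible_X h)
    have hPeq := hspan X (by rw [hQb, Polynomial.map_X])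
    rw [aeval_X, Nat.cast_ofNat, span_2_lin0_eq hα] at hPeq
    exact ⟨⟨-2 + thetaInt hα + 2 * thetaInt hα ^ 2, by rw [hPeq, Ideal.submodule_span_eq]⟩⟩
  · have hQb : Qb = X ^ 2 + X + 1 :=
      eq_of_monic_of_associated hmon (by monicity!) (hirr.associated_of_dvd CubicDisc307.irreducible_quad_two h)
    have hPeq := hspan (X ^ 2 + X + 1) (by rw [hQb]; simp)
    rw [show aeval (thetaInt hα) (X ^ 2 + X + 1 : ℤ[X]) = thetaInt hα ^ 2 + thetaInt hα + 1 by
        simp only [map_add, map_pow, aeval_X, map_one], Nat.cast_ofNat, span_2_quad_eq hα] at hPeq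
    exact ⟨⟨487 - 167 * thetaInt hα + 39 * thetaInt hα ^ 2, by rw [hPeq, Ideal.submodule_span_eq]⟩⟩

/-- `(3, θ + 2) = (-37 - 34 * θ - 4 * θ ^ 2)` (an element of norm `±3`). [cite: Marcus2018, Ch. 3, Thm. 27] -/
theorem span_3_lin2_eq (hα : aeval α (poly (-3) (7) (16)) = 0) :
    span {(3 : 𝓞 F), thetaInt hα + 2} = span {-37 - 34 * thetaInt hα - 4 * thetaInt hα ^ 2} := by
  have hrel := theta_rel hα
  apply le_antisymm
  · rw [span_le]
    rintro x hx
    rcases hx with rfl | hx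
    · exact mem_span_singleton'.mpr ⟨-19079 + 6542 * thetaInt hα - 1528 * thetaInt hα ^ 2, by linear_combination (44120 + 6112 * thetaInt hα) * hrel⟩
    · rw [Set.mem_singleton_iff.mp hx]
      exact mem_span_singleton'.mpr ⟨-4570 + 1567 * thetaInt hα - 366 * thetaInt hα ^ 2, by linear_combination (10568 + 1464 * thetaInt hα) * hrel⟩
  · rw [span_singleton_le_iff_mem, mem_span_pair]
    exact ⟨-35 - 17 * thetaInt hα + 9 * thetaInt hα ^ 2, -6 - 6 * thetaInt hα - 5 * thetaInt hα ^ 2, by linear_combination (-5) * hrel⟩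

/-- `(3, θ² + 1θ + 2) = (575 + 154 * θ - 230 * θ ^ 2)` (an element of norm `9`). [cite: Marcus2018, Ch. 3, Thm. 27] -/
theorem span_3_quad_eq (hα : aeval α (poly (-3) (7) (16)) = 0) :
    span {(3 : 𝓞 F), thetaInt hα ^ 2 + thetaInt hα + 2} = span {575 + 154 * thetaInt hα - 230 * thetaInt hα ^ 2} := by
  have hrel := theta_rel hα
  apply le_antisymm
  · rw [span_le]
    rintro x hx
    rcases hx with rfl | hx
    · exact mem_span_singleton'.mpr ⟨-1748099 + 599406 * thetaInt hα - 140002 * thetaInt hα ^ 2, by linear_combination (-62822308 + 32200460 * thetaInt hα) * hrel⟩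
    · rw [Set.mem_singleton_iff.mp hx]
      exact mem_span_singleton'.mpr ⟨-1375522 + 471653 * thetaInt hα - 110163 * thetaInt hα ^ 2, by linear_combination (-49432822 + 25337490 * thetaInt hα) * hrel⟩
  · rw [span_singleton_le_iff_mem, mem_span_pair]
    exact ⟨57 - 30 * thetaInt hα - 55 * thetaInt hα ^ 2, -6 - 6 * thetaInt hα - 5 * thetaInt hα ^ 2, by linear_combination (-26 - 5 * thetaInt hα) * hrel⟩

/-- **Every prime of `𝓞_F` above `3` is principal** (Dedekind–Kummer with `polyMod_3` and the generators above).
[cite: Marcus2018, Ch. 3, Thm. 27] [cite: LMFDB, number field 3.1.12163.1 (class number 1)] -/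
theorem isPrincipal_of_mem_primesOver_3 (h3 : finrank ℚ F = 3) (hα : aeval α (poly (-3) (7) (16)) = 0) {P : Ideal (𝓞 F)}
    (hP : P ∈ primesOver (span {((3 : ℕ) : ℤ)}) (𝓞 F)) : Submodule.IsPrincipal P := by
  haveI : Fact (Nat.Prime 3) := ⟨by norm_num⟩
  obtain ⟨Qb, hirr, hmon, hdvd, -, hspan⟩ :=
    exists_factor_of_mem_primesOver irreducible_polyQ hα h3 isUnit_of_disc_eq_sq_mul (by norm_num : Nat.Prime 3) hP
  rw [polyMod_3] at hdvd
  rcases hirr.prime.dvd_or_dvd hdvd with h | h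
  · have hirr1 : Irreducible (X + 2 : (ZMod 3)[X]) := by
      rw [show (X + 2 : (ZMod 3)[X]) = X - C (-2) by rw [map_neg, map_ofNat]; ring]
      exact irreducible_X_sub_C _
    have hQb : Qb = X + 2 := eq_of_monic_of_associated hmon (by monicity!) (hirr.associated_of_dvd hirr1 h)
    have hPeq := hspan (X + C 2) (by rw [hQb]; simp [map_ofNat])
    rw [show aeval (thetaInt hα) (X + C 2 : ℤ[X]) = thetaInt hα + 2 by
        simp only [map_add, aeval_X, aeval_C, algebraMap_int_eq, Int.coe_castRingHom, Int.cast_ofNat], Nat.cast_ofNat, span_3_lin2_eq hα] at hPeq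
    exact ⟨⟨-37 - 34 * thetaInt hα - 4 * thetaInt hα ^ 2, by rw [hPeq, Ideal.submodule_span_eq]⟩⟩
  · have hQb : Qb = X ^ 2 + X + 2 :=
      eq_of_monic_of_associated hmon (by monicity!) (hirr.associated_of_dvd CubicDisc307.irreducible_quad_three h)
    have hPeq := hspan (X ^ 2 + X + C 2) (by rw [hQb]; simp [map_ofNat])
    rw [show aeval (thetaInt hα) (X ^ 2 + X + C 2 : ℤ[X]) = thetaInt hα ^ 2 + thetaInt hα + 2 by
        simp only [map_add, map_pow, aeval_X, aeval_C, algebraMap_int_eq, Int.coe_castRingHom, Int.cast_ofNat], Nat.cast_ofNat, span_3_quad_eq hα] at hPeq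
    exact ⟨⟨575 + 154 * thetaInt hα - 230 * thetaInt hα ^ 2, by rw [hPeq, Ideal.submodule_span_eq]⟩⟩

/-- `(5, θ + 1) = (-1 - θ)` (an element of norm `±5`). [cite: Marcus2018, Ch. 3, Thm. 27] -/
theorem span_5_lin1_eq (hα : aeval α (poly (-3) (7) (16)) = 0) :
    span {(5 : 𝓞 F), thetaInt hα + 1} = span {-1 - thetaInt hα} := by
  have hrel := theta_rel hα
  apply le_antisymm
  · rw [span_le]
    rintro x hx
    rcases hx with rfl | hx
    · exact mem_span_singleton'.mpr ⟨11 - 4 * thetaInt hα + thetaInt hα ^ 2, by linear_combination (-1) * hrel⟩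
    · rw [Set.mem_singleton_iff.mp hx]
      exact mem_span_singleton'.mpr ⟨-1, by linear_combination ((0 : 𝓞 F)) * hrel⟩
  · rw [span_singleton_le_iff_mem, mem_span_pair]
    exact ⟨-15 - 5 * thetaInt hα + 5 * thetaInt hα ^ 2, -6 - 5 * thetaInt hα - 5 * thetaInt hα ^ 2, by linear_combination (-5) * hrel⟩

/-- `(5, θ² + 1θ + 1) = (-11 + 4 * θ - θ ^ 2)` (an element of norm `25`). [cite: Marcus2018, Ch. 3, Thm. 27] -/
theorem span_5_quad_eq (hα : aeval α (poly (-3) (7) (16)) = 0) :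
    span {(5 : 𝓞 F), thetaInt hα ^ 2 + thetaInt hα + 1} = span {-11 + 4 * thetaInt hα - thetaInt hα ^ 2} := by
  have hrel := theta_rel hα
  apply le_antisymm
  · rw [span_le]
    rintro x hx
    rcases hx with rfl | hx
    · exact mem_span_singleton'.mpr ⟨1 + thetaInt hα, by linear_combination (-1) * hrel⟩
    · rw [Set.mem_singleton_iff.mp hx]
      exact mem_span_singleton'.mpr ⟨-3 - thetaInt hα + thetaInt hα ^ 2, by linear_combination (2 - thetaInt hα) * hrel⟩
  · rw [span_singleton_le_iff_mem, mem_span_pair]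
    exact ⟨-97 - 58 * thetaInt hα + 13 * thetaInt hα ^ 2, -6 - 6 * thetaInt hα - 6 * thetaInt hα ^ 2, by linear_combination (-30 - 6 * thetaInt hα) * hrel⟩

/-- **Every prime of `𝓞_F` above `5` is principal** (Dedekind–Kummer with `polyMod_5` and the generators above).
[cite: Marcus2018, Ch. 3, Thm. 27] [cite: LMFDB, number field 3.1.12163.1 (class number 1)] -/
theorem isPrincipal_of_mem_primesOver_5 (h3 : finrank ℚ F = 3) (hα : aeval α (poly (-3) (7) (16)) = 0) {P : Ideal (𝓞 F)}
    (hP : P ∈ primesOver (span {((5 : ℕ) : ℤ)}) (𝓞 F)) : Submodule.IsPrincipal P := by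
  haveI : Fact (Nat.Prime 5) := ⟨by norm_num⟩
  obtain ⟨Qb, hirr, hmon, hdvd, -, hspan⟩ :=
    exists_factor_of_mem_primesOver irreducible_polyQ hα h3 isUnit_of_disc_eq_sq_mul (by norm_num : Nat.Prime 5) hP
  rw [polyMod_5] at hdvd
  rcases hirr.prime.dvd_or_dvd hdvd with h | h
  · have hirr1 : Irreducible (X + 1 : (ZMod 5)[X]) := by
      rw [show (X + 1 : (ZMod 5)[X]) = X - C (-1) by rw [map_neg, map_one, sub_neg_eq_add]]
      exact irreducible_X_sub_C _
    have hQb : Qb = X + 1 := eq_of_monic_of_associated hmon (by monicity!) (hirr.associated_of_dvd hirr1 h)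
    have hPeq := hspan (X + 1) (by rw [hQb]; simp)
    rw [show aeval (thetaInt hα) (X + 1 : ℤ[X]) = thetaInt hα + 1 by
        simp only [map_add, aeval_X, map_one], Nat.cast_ofNat, span_5_lin1_eq hα] at hPeq
    exact ⟨⟨-1 - thetaInt hα, by rw [hPeq, Ideal.submodule_span_eq]⟩⟩
  · have hQb : Qb = X ^ 2 + X + 1 :=
      eq_of_monic_of_associated hmon (by monicity!) (hirr.associated_of_dvd CubicDisc3523.irreducible_quad_5 h)
    have hPeq := hspan (X ^ 2 + X + 1) (by rw [hQb]; simp)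
    rw [show aeval (thetaInt hα) (X ^ 2 + X + 1 : ℤ[X]) = thetaInt hα ^ 2 + thetaInt hα + 1 by
        simp only [map_add, map_pow, aeval_X, map_one], Nat.cast_ofNat, span_5_quad_eq hα] at hPeq
    exact ⟨⟨-11 + 4 * thetaInt hα - thetaInt hα ^ 2, by rw [hPeq, Ideal.submodule_span_eq]⟩⟩

/-- `(7, θ + 6) = (1035 + 677 * θ - 102 * θ ^ 2)` (an element of norm `±7`). [cite: Marcus2018, Ch. 3, Thm. 27] -/
theorem span_7_lin6_eq (hα : aeval α (poly (-3) (7) (16)) = 0) :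
    span {(7 : 𝓞 F), thetaInt hα + 6} = span {1035 + 677 * thetaInt hα - 102 * thetaInt hα ^ 2} := by
  have hrel := theta_rel hα
  apply le_antisymm
  · rw [span_le]
    rintro x hx
    rcases hx with rfl | hx
    · exact mem_span_singleton'.mpr ⟨5363653 - 1839144 * thetaInt hα + 429565 * thetaInt hα ^ 2, by linear_combination (346961303 - 43815630 * thetaInt hα) * hrel⟩
    · rw [Set.mem_singleton_iff.mp hx]
      exact mem_span_singleton'.mpr ⟨3615554 - 1239738 * thetaInt hα + 289563 * thetaInt hα ^ 2, by linear_combination (233881149 - 29535426 * thetaInt hα) * hrel⟩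
  · rw [span_singleton_le_iff_mem, mem_span_pair]
    exact ⟨153 + 101 * thetaInt hα - 14 * thetaInt hα ^ 2, -6 - 4 * thetaInt hα, by linear_combination ((0 : 𝓞 F)) * hrel⟩

/-- **Every prime of `𝓞_F` above `7` with `7^f ≤ 31` is principal** (Dedekind–Kummer with `polyMod_7` and the generators above).
[cite: Marcus2018, Ch. 3, Thm. 27] [cite: LMFDB, number field 3.1.12163.1 (class number 1)] -/
theorem isPrincipal_of_mem_primesOver_7 (h3 : finrank ℚ F = 3) (hα : aeval α (poly (-3) (7) (16)) = 0) {P : Ideal (𝓞 F)}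
    (hP : P ∈ primesOver (span {((7 : ℕ) : ℤ)}) (𝓞 F))
    (hle : 7 ^ P.inertiaDeg ℤ ≤ 31) : Submodule.IsPrincipal P := by
  haveI : Fact (Nat.Prime 7) := ⟨by norm_num⟩
  obtain ⟨Qb, hirr, hmon, hdvd, hdeg, hspan⟩ :=
    exists_factor_of_mem_primesOver irreducible_polyQ hα h3 isUnit_of_disc_eq_sq_mul (by norm_num : Nat.Prime 7) hP
  rw [polyMod_7] at hdvd
  rcases hirr.prime.dvd_or_dvd hdvd with h | h
  · have hirr1 : Irreducible (X + 6 : (ZMod 7)[X]) := by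
      rw [show (X + 6 : (ZMod 7)[X]) = X - C (-6) by rw [map_neg, map_ofNat]; ring]
      exact irreducible_X_sub_C _
    have hQb : Qb = X + 6 := eq_of_monic_of_associated hmon (by monicity!) (hirr.associated_of_dvd hirr1 h)
    have hPeq := hspan (X + C 6) (by rw [hQb]; simp [map_ofNat])
    rw [show aeval (thetaInt hα) (X + C 6 : ℤ[X]) = thetaInt hα + 6 by
        simp only [map_add, aeval_X, aeval_C, algebraMap_int_eq, Int.coe_castRingHom, Int.cast_ofNat], Nat.cast_ofNat, span_7_lin6_eq hα] at hPeq
    exact ⟨⟨1035 + 677 * thetaInt hα - 102 * thetaInt hα ^ 2, by rw [hPeq, Ideal.submodule_span_eq]⟩⟩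
  · have hQb : Qb = X ^ 2 + 5 * X + 5 :=
      eq_of_monic_of_associated hmon (by monicity!) (hirr.associated_of_dvd irreducible_quad_7 h)
    exfalso
    have hd2 : (X ^ 2 + 5 * X + 5 : (ZMod 7)[X]).natDegree = 2 := by compute_degree!
    rw [hdeg, hQb, hd2] at hle
    norm_num at hle

/-- **Every prime of `𝓞_F` above `11` is principal**: `11` is inert, the prime is `(11)`. [cite: Marcus2018, Ch. 3, Thm. 27] -/
theorem isPrincipal_of_mem_primesOver_11 (h3 : finrank ℚ F = 3) (hα : aeval α (poly (-3) (7) (16)) = 0) {P : Ideal (𝓞 F)}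
    (hP : P ∈ primesOver (span {((11 : ℕ) : ℤ)}) (𝓞 F)) : Submodule.IsPrincipal P := by
  have hPeq := eq_span_of_no_root irreducible_polyQ hα h3 isUnit_of_disc_eq_sq_mul (by norm_num : Nat.Prime 11) hP no_root_11
  exact ⟨⟨((11 : ℕ) : 𝓞 F), by rw [hPeq, Ideal.submodule_span_eq]⟩⟩

end NumberField

end Literature.NumberTheory.CubicFields.CubicDisc12163

end
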